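import Literature.MathematicalPhysics.QuantumFieldTheory.Balaban1983to89.B6Line3CubePadV1L0
import HarnessLib
import Literature.MathematicalPhysics.QuantumFieldTheory.Balaban1983to89.B6Cover236MultiLevelBlocksL0
import Literature.MathematicalPhysics.QuantumFieldTheory.Balaban1983to89.B6CubeWindowV1L0
import Literature.MathematicalPhysics.QuantumFieldTheory.Balaban1983to89.B6Geom246MultiLevelBoxL0
import Literature.MathematicalPhysics.QuantumFieldTheory.Balaban1983to89.B6Geom246MultiLevelTorusL0
import Literature.MathematicalPhysics.QuantumFieldTheory.Balaban1983to89.B6GlobalChartV1L0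
import Literature.MathematicalPhysics.QuantumFieldTheory.Balaban1983to89.B6GluedDistWindowL0
import Literature.MathematicalPhysics.QuantumFieldTheory.Balaban1983to89.B6Line3CubeV1L0
import Literature.MathematicalPhysics.QuantumFieldTheory.Balaban1983to89.B6Line3CutoffV1L0
import Literature.MathematicalPhysics.QuantumFieldTheory.Balaban1983to89.B6Line3GapV1L0
import Literature.MathematicalPhysics.QuantumFieldTheory.Balaban1983to89.B6Line3ProfileV1L0
import Literature.MathematicalPhysics.QuantumFieldTheory.Balaban1983to89.B6Line3WindowV1L0
import Literature.MathematicalPhysics.QuantumFieldTheory.Balaban1983to89.B6MemberLevelsWindowL0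
import Literature.MathematicalPhysics.QuantumFieldTheory.Balaban1983to89.B6MemberOfCubeV1L0
import Literature.MathematicalPhysics.QuantumFieldTheory.Balaban1983to89.B6MemberTorusTDomainsV1L0
import Literature.MathematicalPhysics.QuantumFieldTheory.Balaban1983to89.B6MultiLevelBoxOperatorL0
import Literature.MathematicalPhysics.QuantumFieldTheory.Balaban1983to89.B6MultiLevelTorusOperatorL0
import Literature.MathematicalPhysics.QuantumFieldTheory.Balaban1983to89.B6PadLevelV1L0
import Literature.MathematicalPhysics.QuantumFieldTheory.Balaban1983to89.B6Partition118KLevelFineL0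
import Literature.MathematicalPhysics.QuantumFieldTheory.Balaban1983to89.B6Partition118KLevelFineLipL0
import Literature.MathematicalPhysics.QuantumFieldTheory.Balaban1983to89.B6Partition118KLevelTorusCentralL0
import Literature.MathematicalPhysics.QuantumFieldTheory.Balaban1983to89.B6Prop26KLevelAssemblyV1L0
import Literature.MathematicalPhysics.QuantumFieldTheory.Balaban1983to89.B6Prop26KLevelSkeletonV1L0
import Literature.MathematicalPhysics.QuantumFieldTheory.Balaban1983to89.B6ScalarFactorsChartV1L0
import Literature.MathematicalPhysics.QuantumFieldTheory.Balaban1983to89.B6TorusDepthDistanceL0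
import Literature.MathematicalPhysics.QuantumFieldTheory.Balaban1983to89.B6TranslateTorusV1L0
import Literature.MathematicalPhysics.QuantumFieldTheory.Balaban1983to89.B8Ineq192MultiLevelTorusL0

/-!
# `Balaban1983to89.B6Line3CubeTransposeV1L0` — LEVEL-0 TWIN (programme G-F3′-L0, director-ym LINE №27 / UV3-NODE §24.5; plan `lit-balaban-r03/G-F3L0-PLAN.md`) of `B6Line3CubeTransposeV1`:
the same declarations, SAME NAMES AND STATEMENTS, for nested families WITH print's region `Λ₀ = T ∖ Ω₁` ADMITTED (structures
`B6MultiLevelBoxOperatorL0.Domains` / `B6MultiLevelTorusOperatorL0.TDomains`: levels `0, …, k`, the level-`0` block a single site, `Q′₀ = id`,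
finite weight `a₀` — print p.225 (2.14) «Σ_{j=0}^k … (Q′₀λ)(x) = λ(x), x ∈ Λ₀», p.229 «taking a sequence (2.1) … smallest possible domains B^j(Λ_j),
and considering the operator Δ_a defined by (2.19), (2.20) for this sequence»).  Every `D`-free object is the lineage's, consumed BY NAME; no existing
module is touched; no fact is minted.  Unit `lit-balaban-p33` (p33 gen 101; programme RIGHT-ENTRY-L0 = the (2.136)₃ right-factor chain at level 0, the input of [B9] Thm 3.3's right entry (3.42)₃ for the bond-sector cube letter G_□(1), cell GAPS G-B9-02; port tooling by r03 gen 36–37); B6 fold owner r03; referee ref-4.  THE TWIN'S DOCUMENTATION FOLLOWS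
VERBATIM (its «levels 1 … k» / «Ω₁ = X» sentences describe the twin; here `j` runs from `0` and `Ω₁` may be a proper subset).

# `Balaban1983to89.B6Line3CubeTransposeV1` — T. Bałaban, *Propagators and renormalization transformations for lattice gauge theories. II*,
# Commun. Math. Phys. **96** (1984) 223–250 [Balaban1984PropagatorsII], (2.92) p. 239 LINE 3 **TRANSPOSED**, `h_□(∂P∂* − ∂P̃_□∂*)ζ_□`, FOR THE GENUINE
# MEMBER OF EVERY CUBE OF THE k-LEVEL COVER (the line-3 leg of the transposed remainder `Rᵀ` of (2.91), i.e. of OUR column reading of the walk (2.141))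

statement-level skeleton of published theorems with citation tags; proofs where landed; nothing here is a claim about the Yang–Mills mass gap

PDF held: `paper:balaban1984-cmp96-propagators-rt-ii` (journal page = PDF page + 222): p. 239 [PDF 17] ((2.91)–(2.92): *"ζ_□(∂P∂* − ∂P_□∂*)h_□"*, the
third line of `K_□`), p. 247 [PDF 25] ((2.134); Prop. 2.6 (2.136); (2.141): *"G = G₀(I − R)⁻¹ = Σ_{n=0}^∞ G₀Rⁿ = Σ_{ω=(□₀,…,□₂ₙ)} h_{□₀}G_{□₀}h_{□₀}·K_{□₁,□₂}G_{□₂}h_{□₂}· … ·K_{□₂ₙ₋₁,□₂ₙ}G_{□₂ₙ}h_{□₂ₙ}"*, *"and the series above is convergent in the norms appearing in the inequalities (2.136)–(2.140)"* — reading this walk on the COLUMNS of `G` (remainder transposed) is OURS (p38 g31's (2.136)₃ route), not displayed in print), p. 238 [PDF 16] (*"we take the cube □̃³ and identify it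
with a torus T_□"*), p. 231 [PDF 9] ((2.45)–(2.46)).  v1.1 (DOCFIX D-g75-1, ref-4 gen 75): the v1.0 header paraphrased (2.141) with cut-offs `ζ` and
attributed a phrase *"their conjugates"* to p. 247 — neither is print; (2.141) is now quoted verbatim and the column reading labelled ours.  Lean unchanged.

CITATION HEADER (lean-in-tree rule) — WHAT IS REPRODUCED.  Phase-2 file of the `lit-balaban` typed skeleton (HOME `run/shared/lean/pub/lit-balaban/`), unit
`lit-balaban-p22` (gen 23), referee ref-4; B6 fold owner r03.  SKELETON rows **B6.Prop2.6** × **B6.Eq2.92** × B6.Eq2.134 × B6.Eq2.46 (cells only; decls of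
record untouched).  IMPORTS BY NAME, restating nothing: r03's `…B6Line3CubeV1` (the whole cube bookkeeping of `line3_cube`: the member family `Dmem`,
`hN1_cube`, `hdivB_cube`, `hal_cube`, `hlevW_cube`, `jlo_cube` (§1); the chart-frame cut-offs `zch`, `hch` and `blkS_mem_Qbig_of_zch/hch`,
`abs_lab_sub_ctr_le` (§2); `chiC`, `cLC`, `hlo_cube`, `hhi_cube`, `hwin_cube`, `zone_nonempty` (§3); `depth_cube` (§4); `distT_le_of_mem_Qbig` (§5);
`hasMajorant_cut_of_diam` (§6); `absorb` (§8)), p22's `…B6Line3WindowV1` (**`line3_window`**, `sandwich_transplant_eq`, `onFun_dE_dsE_rescale`,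
`onFun_tsV1_P`), p22's `…B6Line3CubePadV1` pattern for the padded family (p38's `B6PadLevelV1L0.padT`, `B6Prop26KLevelAssemblyPadV1.hLP_of_V1`), r03's
`…B6Line3CutoffV1` (`hEL_cL` and the dischargers of `χ_c`), `…B6Line3ProfileV1` (`profile_torus`, `budget_of_rate`, `CDgk_mono/scale`), `…B6CubeWindowV1`
(`tC`, `PlC`, `Pl`, `hch`, `trV_hB`, `Placed`), `…B6TranslateTorusV1` (`TB`, `mulOp_eq_conj`, `onFun_dgPart_eq_conj`, `hasMajorant_conj_chart`),
`…B6Prop26KLevelAssemblyV1` (`hasMajorant_TB`, `hasMajorant_T_of_TB`), `…B6ScalarAgreeV1Chart` (`transplant_GSG`), `…B6ScalarFactorsChartV1` (`GpV`, `SV`,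
`onFun_oneSubRE_eq`).  Nothing of r03 / p38 is restated or modified; r03's three private one-liners (`hasMajorant_of_eq`, `conj_sub`, `kernel_rearrange`)
are re-proved locally.

## WHY (the consumer).  Print displays the walk (2.141) `G = Σ_n G₀Rⁿ` and states its convergence *"in the norms appearing in the inequalities
(2.136)–(2.140)"*, among them the right entry `|(G∇*J)(x)|` of (2.136).  OUR route to that entry at k levels (p38 g31's programme) runs the walk on the
COLUMNS of `G`, i.e. uses `G = G₀ᵀ + (RG)ᵀ`-type expansions whose remainder is the TRANSPOSE `Rᵀ = Σ_□ h_□G_□K_□ᵀ` of the remainder of (2.91); the third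
line of `K_□ᵀ` is `(ζ_□Xh_□)ᵀ = h_□Xζ_□` for the ℓ²-symmetric `X = ∂(1−R)∂* − P_□`.  A block sup-majorant (`HasMajorant`)
does NOT transpose abstractly (row sums ≠ column sums), so the transposed line 3 is proved by re-running r03's assembly with the cut-offs exchanged.
This file is the line-3 input of that mirror route (p38 g31's announced (2.136)₃ target); the mirror skeleton / legs are NOT in this file.

## WHAT THIS FILE CERTIFIES (kernel-checked, 0 sorry, standard axioms; no `def`, no `def … : Prop`, no new named fact)

* §1 three one-line helpers (r03's private ones, re-proved);
* §2 **`target_eq_conj_transpose`** (`h_□(∂(1−R)∂* − P_□)ζ_□ = τ_{−v}(h^ch_□(∂(1−R^ch)∂* − P^ch_□)ζ^ch_□)τ_v`) and **`chart_eq_line3_transpose`** (the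
  chart-frame operator IS `line3_window`'s `h(∂(G′SG′ − G̃′_□S̃_□G̃′_□)∂*)ζ`) — r03's `target_eq_conj` / `chart_eq_line3` with the cut-offs exchanged
  (`sandwich_transplant_eq` is symmetric in its two deep cut-offs);
* §3 **`line3_cube_transpose`** — `∃ ρ₃ > 0, C_D ≥ 0, c_D > 0, M₃` with, for every V1 global torus (`k ≥ 2`, `M_h = L^a ≥ 8`, `M₃ ≤ L·M_h`, `R ≥ 2L²`,
  `P′ ≥ 5`, `L ≥ 5`, cubes placed), every `c_f ≠ 0`, all weights `w`, every cube `□`: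
  `HasMajorant (geomTB D) (blkV1 hN D) (h_□(∂(1−R)∂* − P_□)ζ_□) (C_D c_f² e^{−c_D LM_h}/len(y)²·e^{−ρ₃ d_T(y,y″)})` — binders and kernel VERBATIM those
  of r03's `line3_cube`, the operator's cut-offs exchanged; proof = r03's assembly re-run: `line3_window` with `(h^ch_□, ζ^ch_□)` (its plateau identity
  `hEL` for `h^ch_□` by `hEL_cL` + `blkS_mem_Qbig_of_hch`), the depths and the diameter with the cut-offs exchanged, `hasMajorant_cut_of_diam (hch) (zch)`,
  §2, `hasMajorant_conj_chart`, `absorb`; the constants come out IDENTICAL to r03's (same formulae);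
* §4 **`line3_cube_transpose_pad`**, **`line3_cube_transpose_pad_le`** — the same for the cube members of p38's PADDED family `padT D` (every odd
  `L ≥ 5`, `k ≥ 1`, `P′ ≥ 5L`, NO placement hypothesis; rate any `r ≤ ρ₃`), verbatim the pattern of p22's `B6Line3CubePadV1`.

## HONEST SCOPE / DIVERGENCES

(1) Print does not display the transposed line 3 (nor a column form of (2.141)); it displays the walk (2.141) for `G` and asserts its convergence in
the norms of (2.136)–(2.140); the transposed remainder and this file's operator are OUR bookkeeping for the right entries.  The cut-off `χ_c(ctr, 8S_j/3)`, depth `M_h/(4L)`, diameter `(d+1)(4L²+1)M_h`, rates `κ = δ/8`, `ρ₃ = c₁/(4c_Δ)`, `c_D = c₁/(2L)` and the constant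
`C_D` are r03's bookkeeping for ROUTE V, unchanged; only their existence is asserted.  (2) The hypotheses are print's SETTING as in `line3_cube` ((2.2) `M`
large, `R ≥ 2L²`; V1 torus with `k ≥ 2`, `P′ ≥ 5`, `L ≥ 5`, placement — discharged in §4 on the padded family for every odd `L ≥ 5`).  (3) Distance (2.46)
in p21's reading R2; integer torus, lattice units; nothing here on (2.136)₂₋₄ / (2.137)–(2.140) themselves, on d = 4 or the continuum; NOT summit progress.
(4) Theorems only; no `def`, no `def … : Prop`; standard axioms.  Unit `lit-balaban-p22` (gen 23), 2026-08-23.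
-/

noncomputable section

open scoped BigOperators
open Finset

namespace Literature.MathematicalPhysics.QuantumFieldTheory.Balaban1983to89.B6Line3CubeTransposeV1L0

open LatticeFieldCalculus
open B4Reflection242 (boxDom mem_boxDom blk)
open B4ContourShift (supNorm)
open B6MultiLevelBoxOperator (N0 bigSide one_le_bigSide)
open B6MultiLevelBoxOperatorL0 (Domains)
open B6MultiLevelTorusOperator (N0_eq_bigSide_mul)
open B6MultiLevelTorusOperatorL0 (TDomains)
open B6Eq238MultiLevelTorus (svec)
open B6Cover236MultiLevelBlocksL0 (cubes ctr side Q)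
open B6Geom246MultiLevelBox (toR supNorm_eq_dist)
open B6Geom246MultiLevelBoxL0 (bset blkOf blkOf_val exists_blkOf_eq dist_blkOf_le_box lev_eq_of_blkOf_eq bond)
open B6Geom246MultiLevelTorusL0 (geomT bondT blkMap blkMap_injective distT_le_dist_box)
open B6TorusDepthDistanceL0 (distT_chart_eq)
open B8Ineq192MultiLevelTorusL0 (geomTB geomTB_len geomTB_M geomTB_dist geomTB_RM)
open B6Partition118KLevelTorusCentral (one_le_of_four_le)
open B6Partition118KLevelTorusCentralL0 (Dch cc side_cc ctr_cc_bounds QbigT zetaT zetaT_nonneg zetaT_le_one)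
open B6Partition118KLevelFineLipL0 (Qbig mem_Qbig Q_subset_Qbig)
open B6Partition118KLevelFineL0 (hF blkOf_mem_Q_of_hF_ne_zero)
open B6GlobalChartV1 (PV toBox toBox_apply toBox_surjective)
open B6GlobalChartV1L0 (domT blkV1)
open B6ScalarFactorsChartV1L0 (blkS blkV1_eq_blkS GpV SV onFun_oneSubRE_eq)
open B6AgreeLapV1Chart (eS eB DeepS DeepB deepS_mono cS cB mem_cB_W onFun_comp transplant_eB_eq posV)
open B6Prop25TwoScaleCensus (TSIdx)
open B6MemberOfCubeV1 (bare)
open B6MemberOfCubeV1L0 (tOf)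
open B6MemberTorusTDomainsV1 (bigLab)
open B6MemberTorusTDomainsV1L0 (famOf j_le_lev)
open B6MemberLevelsWindowL0 (lam_tOf_sat lev_famOf_tOf card_bset_famOf_le)
open B6GluedDistWindowL0 (geomW geomW_len geomW_dist FaceBlk le_distW_of_far distW_nonneg)
open B6RandomWalk (HasMajorant hasMajorant_mono BlockSupp delta3)
open B6Prop26Gluing (mulOp mulOp_apply)
open B6Prop26ReachTransplant (transplant transplant_smul chartBond)
open B6Ineq2133TwoScaleV1 (onFun onFun_apply)
open B6SectAOperatorsV1 (dE dsE RE BondIdx)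
open B6SectAVectorModelV1 (GE)
open B6TranslateV1 (tv trV trV_apply)
open B6TranslateTorusV1 (vch TB TB_mul_TB_neg mulOp_eq_conj)
open B6TranslateTorusV1L0 (hasMajorant_conj_chart onFun_dgPart_eq_conj blkV1_translate blkMap_fst)
open B6Prop26KLevelSkeletonV1L0 (hB zB zB_apply hB_apply abs_hB_le_one pref)
open B6CubeWindowV1 (eC pow_eC x0 pow_dvd_x0 bigSide_dvd_x0 rho Placed GlobalBand band_le one_le_of_eight_le four_le_of_five_le one_le_bigSide_real)
open B6CubeWindowV1L0 (x0_eq_ctr_sub j0 j0_succ_le j0_hj j0_le_level two_level hlev_deep hch hch_apply hx0 hfit tC tC_j sc PlC wC trV_hB Pl)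
open B6CubeInDecayV1 (conj_mul)
open B6Line3WindowV1 (sandwich_transplant_eq onFun_dE_dsE_rescale)
open B6Line3WindowV1L0 (line3_window onFun_tsV1_P)
open B6Line3CutoffV1 (chiS lab lab_eq_toR NearS nearS_mono cL chiS_nonneg chiS_le_one deep_of_near shift_near chiS_deep chiS_jump D1_thetaProf_nonneg D2_thetaProf_nonneg cL_mul_chiS hEL_cL chiS_ne_one_of_corner)
open B6Line3CutoffV1L0 (zoneN hd1_chiS hd1'_chiS hd2_chiS hdb_chiS chi_eq_one_of_not_mem_zoneN chi_const_of_not_mem_zoneN zoneN_nonempty exists_far_of_mem_zoneN)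
open B6Line3GapV1L0 (abs_sub_ctr_le_of_mem_Qbig distT_far)
open B6Line3ProfileV1 (budget_of_rate CDgk_mono CDgk_scale poly_exp_absorb)
open B6Line3ProfileV1L0 (profile_torus)
open B6DomainChangeP2134Sizes (CDgk CDgk_nonneg)
open B6Ineq261LevelGap (K261 K261_nonneg)
open B6DomainChange (Profile)
open B4PartitionUnity22 (thetaProf D1 D2)
open B6Prop26KLevelAssemblyV1L0 (hasMajorant_TB hasMajorant_T_of_TB prop26_2136_kLevel_final_M)
open B6Line3CubeV1 (Mh1 L_mul_Mh1 Mh1_dvd one_le_Mh1 Mc Mh_le_bigSide Mc_pos absorb)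
open B6Line3CubeV1L0 (P1 four_le_P1 hfitC hN1_cube hdivB_cube hal_cube hlevW_cube jlo_cube Dmem zch abs_zch_le_one abs_hch_le_one blkS_mem_Qbig_of_zch blkS_mem_Qbig_of_hch abs_lab_sub_ctr_le hlo_cube hhi_cube hwin_cube zone_nonempty depth_cube distT_le_of_mem_Qbig hasMajorant_cut_of_diam chiC cLC)
open B6PadLevelV1 (hN_pad SameOm.idxB)
open B6PadLevelV1L0 (padT placed_pad sameOm_domT_pad)
open B6Prop26KLevelAssemblyPadV1 (hLP_of_V1 hP5_of_V1 hk'_of_V1)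

variable {d ℓ : ℕ} {hd : 1 ≤ d + 1} {hL : Odd (ℓ + 1) ∧ 1 < ℓ + 1} {a₀ a₁ : ℝ} {m K : ℕ} {Mh k R : ℕ} {P' : Fin (d + 1) → ℕ}

/-! ## §1  Three one-line helpers (r03's private ones of `B6Line3CubeV1`, re-proved here) -/

section Helpers

/-- equal operators have the same majorants. [folklore] -/
private theorem hasMajorant_of_eq {g : B6.Geometry} {T T' : Module.End ℝ (PBond (PV d ℓ m K hd hL) 0 → ℝ)}
    {blk' : PBond (PV d ℓ m K hd hL) 0 → g.Site} {Kk : g.Site → g.Site → ℝ} (h : T' = T) (hm : HasMajorant (g := g) blk' T Kk) :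
    HasMajorant (g := g) blk' T' Kk := h ▸ hm

/-- rearranging the transported kernel (`e^{−c₁M/4}·e^{c₁M/4} = 1`). [folklore] -/
private theorem kernel_rearrange {G B E₂ E₄ E₄' q l E : ℝ} (h : E₄ * E₄' = 1) :
    G * B * E₂ * E₄ * (q / l) * E₄' * E ≤ G * B * q * E₂ / l * E := by
  apply le_of_eq
  calc G * B * E₂ * E₄ * (q / l) * E₄' * E = G * B * q * E₂ / l * E * (E₄ * E₄') := by ring
    _ = _ := by rw [h, mul_one]

end Helpers

/-! ## §2  The transposed operator of line 3 for the cube: global = conjugate of the chart frame; chart frame = `line3_window`'s operator, cut-offs exchanged -/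

section Identify

variable (hN : ∀ μ, N0 ℓ Mh k P' μ = (PV d ℓ m K hd hL).sitesPerDir 0) {D : TDomains d ℓ Mh k P' R} (hk : k ≤ m + K)
  (hMh1 : 1 ≤ Mh) (hP4 : ∀ μ, 4 ≤ P' μ) {a : ℕ} (hMha : Mh = (ℓ + 1) ^ a) (c : ↥(cubes D.toDomains)) (ha : a₀ ≤ a₁)

omit hN hk hMh1 hP4 c in
/-- conjugates subtract. [cite: Balaban1984PropagatorsII, (2.19) p.226, dictionary] -/
private theorem conj_sub (v : Site (PV d ℓ m K hd hL) 0) (A B : Module.End ℝ (PBond (PV d ℓ m K hd hL) 0 → ℝ)) :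
    TB (-v) * A * TB v - TB (-v) * B * TB v = TB (-v) * (A - B) * TB v := by
  rw [mul_sub, sub_mul]

include hMha in
/-- **THE TRANSPOSED LINE-3 OPERATOR OF THE CUBE IS THE CONJUGATE OF ITS CHART-FRAME VERSION**:
`h_□(∂(1−R)∂* − P_□)ζ_□ = τ_{−v}·(h^ch_□(∂(1−R^ch)∂* − P^ch_□)ζ^ch_□)·τ_v` — r03's `B6Line3CubeV1L0.target_eq_conj` with the two cut-offs exchanged, same
rewrites (`B6TranslateTorusV1L0.onFun_dgPart_eq_conj`, `mulOp_eq_conj`, `trV_hB`, `Pl = τ_{−v}PlCτ_v`).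
[cite: Balaban1984PropagatorsII, (2.19) p.226, (2.91)–(2.92) p.239, dictionary (charts); bookkeeping ours] -/
theorem target_eq_conj_transpose (hpl : Placed ℓ k P' c.1) (w : BondIdx (B6GlobalChartV1L0.domT hN D hk) → ℝ) (cf : ℝ) :
    mulOp (hB hN D c) * (onFun (dE (P := PV d ℓ m K hd hL) cf ∘ₗ (LinearMap.id - RE (domT hN D hk) cf) ∘ₗ dsE cf) -
        Pl hN hk hMh1 hP4 hMha c ha hpl w cf) * mulOp (zB hN D hMh1 hP4 c) =
      TB (-vch Mh k (svec ℓ k c.1.1 c.1.2)) *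
        (mulOp (hch hN hMh1 hP4 c) *
          (onFun (dE (P := PV d ℓ m K hd hL) cf ∘ₗ (LinearMap.id - RE (domT hN (D.chart (svec ℓ k c.1.1 c.1.2)) hk) cf) ∘ₗ dsE cf) -
            PlC hN hk hMh1 hP4 hMha c ha hpl (wC hN hk c w) cf) * mulOp (zch hN hMh1 hP4 c)) *
        TB (vch Mh k (svec ℓ k c.1.1 c.1.2)) := by
  rw [mulOp_eq_conj (vch Mh k (svec ℓ k c.1.1 c.1.2)) (zB hN D hMh1 hP4 c), mulOp_eq_conj (vch Mh k (svec ℓ k c.1.1 c.1.2)) (hB hN D c),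
    trV_hB hN hMh1 hP4 c, onFun_dgPart_eq_conj hN D hk (svec ℓ k c.1.1 c.1.2) cf, Pl, conj_sub, conj_mul, conj_mul]

include hMha in
/-- **THE TRANSPOSED CHART-FRAME LINE-3 OPERATOR OF THE CUBE IS `line3_window`'s OPERATOR WITH THE CUT-OFFS EXCHANGED** (r03's
`B6Line3CubeV1L0.chart_eq_line3` verbatim with `h^ch_□` on the left and `ζ^ch_□` on the right) for the member `t(□)` and its family `D_□`:
`∂(1−R^ch)∂* = ∂·G′SG′·∂*` (`onFun_oneSubRE_eq`), `P^ch_□ = ε_B(∂_□P_□∂*_□)ρ_B` with the unit `s(□)` absorbed by the rescaling of the stencils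
(`onFun_dE_dsE_rescale`), `= ∂(ε_S P_□ ρ_S)∂*` between the deep cut-offs (`sandwich_transplant_eq`), `P_□ = G′_□S_□G′_□` (`onFun_tsV1_P` with
`lam_tOf_sat`) and `ε(G′_□S_□G′_□)ρ = G̃′_□S̃_□G̃′_□` (`transplant_GSG`). [cite: Balaban1984PropagatorsII, (2.17) p.225, (2.90)–(2.92) p.239; derivation ours] -/
theorem chart_eq_line3_transpose (hk2 : 2 ≤ k) (hM8 : 8 ≤ Mh) (hR2 : 2 * (ℓ + 1) ^ 2 ≤ R) (hpl : Placed ℓ k P' c.1)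
    (wc : BondIdx (domT hN (D.chart (svec ℓ k c.1.1 c.1.2)) hk) → ℝ) {cf : ℝ} (hcf : cf ≠ 0)
    (hζd : ∀ b, zch hN hMh1 hP4 c b ≠ 0 → b.src ∈ DeepS (tC hN hk hMh1 hP4 c ha a wc cf) (x0 ℓ Mh k c.1) 1)
    (hhd : ∀ b, hch hN hMh1 hP4 c b ≠ 0 → b.src ∈ DeepS (tC hN hk hMh1 hP4 c ha a wc cf) (x0 ℓ Mh k c.1) 1) :
    mulOp (hch hN hMh1 hP4 c) *
        (onFun (dE (P := PV d ℓ m K hd hL) cf ∘ₗ (LinearMap.id - RE (domT hN (D.chart (svec ℓ k c.1.1 c.1.2)) hk) cf) ∘ₗ dsE cf) -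
          PlC hN hk hMh1 hP4 hMha c ha hpl wc cf) * mulOp (zch hN hMh1 hP4 c) =
      mulOp (hch hN hMh1 hP4 c) * ((onFun (dE (P := PV d ℓ m K hd hL) cf) ∘ₗ
          (GpV hN (D.chart (svec ℓ k c.1.1 c.1.2)) cf * SV hN (D.chart (svec ℓ k c.1.1 c.1.2)) cf * GpV hN (D.chart (svec ℓ k c.1.1 c.1.2)) cf -
            transplant (cS (tC hN hk hMh1 hP4 c ha a wc cf) (x0 ℓ Mh k c.1) (hx0 hpl) (hfitC hN hk hMh1 hP4 hMha c ha hpl wc cf)).W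
                (eS (tC hN hk hMh1 hP4 c ha a wc cf) (x0 ℓ Mh k c.1))
                (GpV (hN1_cube hN hk hMh1 hP4 hMha c ha hM8 hR2 wc cf) (Dmem hN hk hMh1 hP4 c ha a wc cf) cf) *
              transplant (cS (tC hN hk hMh1 hP4 c ha a wc cf) (x0 ℓ Mh k c.1) (hx0 hpl) (hfitC hN hk hMh1 hP4 hMha c ha hpl wc cf)).W
                (eS (tC hN hk hMh1 hP4 c ha a wc cf) (x0 ℓ Mh k c.1))
                (SV (hN1_cube hN hk hMh1 hP4 hMha c ha hM8 hR2 wc cf) (Dmem hN hk hMh1 hP4 c ha a wc cf) cf) *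
              transplant (cS (tC hN hk hMh1 hP4 c ha a wc cf) (x0 ℓ Mh k c.1) (hx0 hpl) (hfitC hN hk hMh1 hP4 hMha c ha hpl wc cf)).W
                (eS (tC hN hk hMh1 hP4 c ha a wc cf) (x0 ℓ Mh k c.1))
                (GpV (hN1_cube hN hk hMh1 hP4 hMha c ha hM8 hR2 wc cf) (Dmem hN hk hMh1 hP4 c ha a wc cf) cf))) ∘ₗ
          onFun (dsE (P := PV d ℓ m K hd hL) cf)) * mulOp (zch hN hMh1 hP4 c) := by
  classical
  have hℓ1 : 1 ≤ ℓ := by have := hL.2; omega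
  have hk1 : 1 ≤ k := by omega
  have hP1 : ∀ μ, 1 ≤ P' μ := one_le_of_four_le hP4
  have hP₁1 : ∀ μ, 1 ≤ P1 hMh1 hP4 c μ := fun μ => le_trans (by norm_num) (four_le_P1 hMh1 hP4 c hℓ1 μ)
  have hLj : ((((ℓ + 1 : ℕ) : ℝ)) ^ j0 hMh1 hP4 c) ≠ 0 := by positivity
  -- (i) the global part
  have e1 : onFun (dE (P := PV d ℓ m K hd hL) cf ∘ₗ (LinearMap.id - RE (domT hN (D.chart (svec ℓ k c.1.1 c.1.2)) hk) cf) ∘ₗ dsE cf) =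
      onFun (dE (P := PV d ℓ m K hd hL) cf) ∘ₗ
        (GpV hN (D.chart (svec ℓ k c.1.1 c.1.2)) cf * SV hN (D.chart (svec ℓ k c.1.1 c.1.2)) cf * GpV hN (D.chart (svec ℓ k c.1.1 c.1.2)) cf) ∘ₗ
        onFun (dsE (P := PV d ℓ m K hd hL) cf) := by
    rw [onFun_comp, onFun_comp, onFun_oneSubRE_eq hN (D.chart (svec ℓ k c.1.1 c.1.2)) hk hℓ1 hMh1 hP1 hcf]
  -- (ii) the member part, unit absorbed
  have e2 : PlC hN hk hMh1 hP4 hMha c ha hpl wc cf =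
      transplant (cB (tC hN hk hMh1 hP4 c ha a wc cf) (x0 ℓ Mh k c.1) (hx0 hpl) (hfitC hN hk hMh1 hP4 hMha c ha hpl wc cf)).W
        (eB (tC hN hk hMh1 hP4 c ha a wc cf) (x0 ℓ Mh k c.1))
        (onFun (dE (P := (tC hN hk hMh1 hP4 c ha a wc cf).P) cf) ∘ₗ onFun (tC hN hk hMh1 hP4 c ha a wc cf).D.P ∘ₗ
          onFun (dsE (P := (tC hN hk hMh1 hP4 c ha a wc cf).P) cf)) := by
    rw [PlC, ← transplant_eB_eq]
    have e3 : onFun ((tC hN hk hMh1 hP4 c ha a wc cf).D.grad ∘ₗ (tC hN hk hMh1 hP4 c ha a wc cf).D.P ∘ₗ (tC hN hk hMh1 hP4 c ha a wc cf).D.dv) =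
        ((((ℓ + 1 : ℕ) : ℝ)) ^ j0 hMh1 hP4 c / cf) ^ 2 •
          onFun (dE (P := (tC hN hk hMh1 hP4 c ha a wc cf).P) cf ∘ₗ (tC hN hk hMh1 hP4 c ha a wc cf).D.P ∘ₗ
            dsE (P := (tC hN hk hMh1 hP4 c ha a wc cf).P) cf) :=
      onFun_dE_dsE_rescale hcf _ _
    rw [e3, transplant_smul, smul_smul, sc, show (cf / (((ℓ + 1 : ℕ) : ℝ)) ^ j0 hMh1 hP4 c) ^ 2 *
      ((((ℓ + 1 : ℕ) : ℝ)) ^ j0 hMh1 hP4 c / cf) ^ 2 = 1 by field_simp, one_smul, onFun_comp, onFun_comp]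
  -- (iii) the member's `P_□ = G′_□S_□G′_□` of `D_□`
  have e4 : onFun (tC hN hk hMh1 hP4 c ha a wc cf).D.P =
      GpV (hN1_cube hN hk hMh1 hP4 hMha c ha hM8 hR2 wc cf) (Dmem hN hk hMh1 hP4 c ha a wc cf) cf *
        SV (hN1_cube hN hk hMh1 hP4 hMha c ha hM8 hR2 wc cf) (Dmem hN hk hMh1 hP4 c ha a wc cf) cf *
        GpV (hN1_cube hN hk hMh1 hP4 hMha c ha hM8 hR2 wc cf) (Dmem hN hk hMh1 hP4 c ha a wc cf) cf :=
    onFun_tsV1_P (hN1_cube hN hk hMh1 hP4 hMha c ha hM8 hR2 wc cf) (j0_hj hMh1 hP4 c a) _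
      (lam_tOf_sat (j0_succ_le hMh1 hP4 c hk1) (hx0 hpl) (hfitC hN hk hMh1 hP4 hMha c ha hpl wc cf) (hdivB_cube hMh1 hP4 hMha c hL hM8 hR2)
        (Mh1_dvd hMha hM8) one_le_Mh1)
      one_le_Mh1 hP₁1 (tC hN hk hMh1 hP4 c ha a wc cf).hc (tC hN hk hMh1 hP4 c ha a wc cf).w hcf
  rw [e1, e2, mul_sub, sub_mul, sandwich_transplant_eq (hx0 hpl) (hfitC hN hk hMh1 hP4 hMha c ha hpl wc cf) cf _ _ _ hhd hζd, e4,
    B6ScalarAgreeV1ChartL0.transplant_GSG]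
  simp only [LinearMap.comp_sub, LinearMap.sub_comp, mul_sub, sub_mul, LinearMap.comp_assoc]

end Identify

/-! ## §3  THE TRANSPOSED LINE 3 OF (2.92) FOR THE GENUINE MEMBER OF EVERY CUBE -/

section Main

set_option maxHeartbeats 6000000 in
/-- **(2.92) LINE 3, TRANSPOSED — `h_□(∂(1−R)∂* − P_□)ζ_□` — FOR THE GENUINE MEMBER OF EVERY CUBE OF THE k-LEVEL COVER** (the line-3 leg of the
transposed remainder `Rᵀ` of the walk (2.91), `(ζ_□Xh_□)ᵀ = h_□Xζ_□` for the ℓ²-symmetric `X = ∂(1−R)∂* − P_□`): there are `ρ₃ > 0`, `C_D ≥ 0`,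
`c_D > 0`, `M₃` (on `d, L` and the constants of `B6Line3WindowV1L0.line3_window`) such that for every V1 global torus with `k ≥ 2`, `M_h = L^a`,
`M₃ ≤ L·M_h`, `R ≥ 2L²`, `P′ ≥ 5`, `L ≥ 5`, all cubes placed, every fine factor `c_f ≠ 0`, all weights `w` and every cube `□`,
`h_□(∂(1−R)∂* − P_□)ζ_□` has the majorant `C_D·c_f²·e^{−c_D·LM_h}/len(y)²·e^{−ρ₃ d_T(y,y″)}` on `𝔅` — binders and kernel shape VERBATIM those of
r03's `B6Line3CubeV1L0.line3_cube`, the two cut-offs of the operator exchanged.  Proof: r03's assembly of `line3_cube` re-run with the roles of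
`ζ^ch_□` and `h^ch_□` exchanged — p22's `line3_window` is symmetric in its two bond cut-offs up to the plateau identity `hEL`, which holds for `h^ch_□`
by the same lemma (`B6Line3CutoffV1.hEL_cL` with `blkS_mem_Qbig_of_hch`); the depth (§4), diameter (§5), cut (§6) and transport steps of
`B6Line3CubeV1` are used BY NAME with the cut-offs exchanged; §2 above identifies the operators.  (A sup-majorant does not transpose abstractly —
row sums and column sums differ — hence the re-run rather than a one-line corollary.)
[cite: Balaban1984PropagatorsII, (2.92) p.239 line 3, (2.134) p.247 («ζ_□(y) − 1 = 0 for d(y, y′) ≦ M»), p.238, (2.141) p.247 (the walk for `G`;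
its column reading ours); assembly ours] -/
theorem line3_cube_transpose (d ℓ : ℕ) (hd : 1 ≤ d + 1) (hL : Odd (ℓ + 1) ∧ 1 < ℓ + 1) {b₀ b₁ : ℝ} (hb₀ : 0 < b₀) (hb₁ : b₀ ≤ b₁) :
    ∃ ρ₃ CD cD M₃ : ℝ, 0 < ρ₃ ∧ 0 ≤ CD ∧ 0 < cD ∧
    ∀ (m K : ℕ) {Mh k R : ℕ} {P' : Fin (d + 1) → ℕ}
      (hN : ∀ μ, N0 ℓ Mh k P' μ = (PV d ℓ m K hd hL).sitesPerDir 0) (D : B6MultiLevelTorusOperatorL0.TDomains d ℓ Mh k P' R) (hk : k ≤ m + K) (_ : 2 ≤ k)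
      {a : ℕ} (hMha : Mh = (ℓ + 1) ^ a) (hM8 : 8 ≤ Mh) (_ : 2 * (ℓ + 1) ^ 2 ≤ R) (hP5 : ∀ μ, 5 ≤ P' μ) (_ : 4 ≤ ℓ)
      (hpl : ∀ c : ↥(cubes D.toDomains), Placed ℓ k P' c.1) (_ : M₃ ≤ ((ℓ : ℝ) + 1) * Mh)
      {cf : ℝ} (_ : cf ≠ 0) (w : BondIdx (B6GlobalChartV1L0.domT hN D hk) → ℝ) (c : ↥(cubes D.toDomains)),
      HasMajorant (g := geomTB D) (blkV1 hN D)
        (mulOp (hB hN D c) *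
          (onFun (dE (P := PV d ℓ m K hd hL) cf ∘ₗ (LinearMap.id - RE (domT hN D hk) cf) ∘ₗ dsE cf) -
            Pl hN hk (one_le_of_eight_le hM8) (four_le_of_five_le hP5) hMha c (band_le (d := d) (ℓ := ℓ) hb₀ hb₁) (hpl c) w cf) *
          mulOp (zB hN D (one_le_of_eight_le hM8) (four_le_of_five_le hP5) c))
        (fun y y'' => CD * cf ^ 2 * Real.exp (-(cD * (geomTB D).M)) / (geomTB D).len y ^ 2 * Real.exp (-(ρ₃ * (geomTB D).dist y y''))) := by
  obtain ⟨M₁, δ, C, hM₁, hδ, hC, hwin⟩ := line3_window d ℓ hd hL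
  -- ### constants (on `d, ℓ, δ, C, M₁` only)
  obtain ⟨κ, hκ⟩ : ∃ κ : ℝ, κ = δ / 8 := ⟨_, rfl⟩
  have hκ0 : 0 ≤ κ := by rw [hκ]; positivity
  have hκδ : 8 * κ ≤ δ := by rw [hκ]; linarith
  have hδ' : 0 < δ - 2 * κ := by rw [hκ]; linarith
  obtain ⟨a₀', ha₀'⟩ : ∃ a₀' : ℝ, a₀' = min 1 ((δ - 2 * κ) / 192) := ⟨_, rfl⟩
  have ha₀'0 : 0 < a₀' := by rw [ha₀']; exact lt_min one_pos (by positivity)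
  have ha₀'1 : a₀' ≤ 1 := by rw [ha₀']; exact min_le_left _ _
  have ha₀'r : a₀' ≤ (δ - 2 * κ) / 192 := by rw [ha₀']; exact min_le_right _ _
  obtain ⟨N₃, hN₃⟩ : ∃ N₃ : ℕ, N₃ = ⌈2 * ((d : ℝ) + 1) * Real.log ((ℓ : ℝ) + 1) / a₀'⌉₊ + 1 := ⟨_, rfl⟩
  have hN₃0 : 0 < N₃ := by rw [hN₃]; exact Nat.succ_pos _
  obtain ⟨K3, hK3⟩ : ∃ K3 : ℝ, K3 = K261 N₃ (d + 1) ((ℓ : ℝ) + 1) 1 (1 * a₀') := ⟨_, rfl⟩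
  have hK30 : 0 ≤ K3 := by rw [hK3]; exact K261_nonneg (by positivity) zero_le_one
  have hL0 : (0 : ℝ) < (ℓ : ℝ) + 1 := by positivity
  obtain ⟨c₁, hc₁⟩ : ∃ c₁ : ℝ, c₁ = (δ - 2 * κ) / 96 / (4 * ((ℓ : ℝ) + 1)) := ⟨_, rfl⟩
  have hc₁0 : 0 < c₁ := by rw [hc₁]; positivity
  obtain ⟨cΔ, hcΔ⟩ : ∃ cΔ : ℝ, cΔ = ((d : ℝ) + 1) * (4 * ((ℓ : ℝ) + 1) ^ 2 + 1) := ⟨_, rfl⟩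
  have hcΔ0 : 0 < cΔ := by rw [hcΔ]; positivity
  obtain ⟨A₁, hA₁⟩ : ∃ A₁ : ℝ, A₁ = 2 * (2 * ((ℓ : ℝ) + 1) ^ 3) ^ (d + 1) := ⟨_, rfl⟩
  have hA₁0 : 0 ≤ A₁ := by rw [hA₁]; positivity
  have hs₁0 : 0 ≤ D1 thetaProf := D1_thetaProf_nonneg
  have hs₂0 : 0 ≤ D2 thetaProf := D2_thetaProf_nonneg
  have hsb0 : 0 ≤ ((d : ℝ) + 1) * D1 thetaProf := by positivity
  obtain ⟨θ, hθ⟩ : ∃ θ : ℝ, θ = ((d : ℝ) + 1) * (D1 thetaProf * C * (1 + Real.exp δ) + D2 thetaProf * C) + ((d : ℝ) + 1) * D1 thetaProf * C :=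
    ⟨_, rfl⟩
  have hθ0 : 0 ≤ θ := by rw [hθ]; positivity
  obtain ⟨Θ₂, hΘ₂⟩ : ∃ Θ₂ : ℝ, Θ₂ = ((Finset.univ : Finset (Fin (d + 1) × Bool)).card : ℝ) *
      ((((ℓ : ℝ) + 1) ^ 3) * D1 thetaProf * (Real.exp (1 + δ) * K3 * (((d : ℝ) + 1) * C))) +
    (((ℓ : ℝ) + 1) ^ 3) ^ 2 * (((d : ℝ) + 1) * D2 thetaProf + ((d : ℝ) + 1) * D1 thetaProf) * C := ⟨_, rfl⟩
  have hΘ₂0 : 0 ≤ Θ₂ := by rw [hΘ₂]; positivity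
  obtain ⟨G₀, hG₀⟩ : ∃ G₀ : ℝ, G₀ = CDgk (((ℓ : ℝ) + 1) ^ 3) C C (((d : ℝ) + 1) * C) θ Θ₂ K3 := ⟨_, rfl⟩
  have hG₀0 : 0 ≤ G₀ := by rw [hG₀]; exact CDgk_nonneg (by positivity) hC.le hC.le (by positivity) hθ0 hΘ₂0 hK30
  obtain ⟨B₆, hB₆⟩ : ∃ B₆ : ℝ, B₆ = (1 + A₁) ^ 6 * (((6 * (d + 1)).factorial : ℝ) / (c₁ / 4) ^ (6 * (d + 1))) := ⟨_, rfl⟩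
  have hB₆0 : 0 ≤ B₆ := by rw [hB₆]; positivity
  -- the four constants
  refine ⟨c₁ / 4 / cΔ, G₀ * B₆, c₁ / 2 / ((ℓ : ℝ) + 1),
    max (max (((ℓ : ℝ) + 1) * M₁) (16 * ((ℓ : ℝ) + 1))) (max (8 / δ * Real.log ((ℓ : ℝ) + 1) + 1) ((N₃ : ℝ) + 1)),
    by positivity, by positivity, by positivity, ?_⟩
  intro m K Mh k R P' hN D hk hk2 a hMha hM8 hR2 hP5 hℓ hpl hM₃ cf hcf w c
  -- ### scalars and thresholds
  have hMh1 : 1 ≤ Mh := one_le_of_eight_le hM8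
  have hP4 : ∀ μ, 4 ≤ P' μ := four_le_of_five_le hP5
  have hP1 : ∀ μ, 1 ≤ P' μ := one_le_of_four_le hP4
  have hℓ1 : 1 ≤ ℓ := le_trans (by norm_num) hℓ
  have hR : 2 * (ℓ + 1) ≤ R := le_trans (by nlinarith) hR2
  have hR3 : 3 * (ℓ + 1) ≤ R := le_trans (by nlinarith) hR2
  have hR1 : 1 ≤ R := le_trans (by omega) hR
  have hMr : (1 : ℝ) ≤ Mh := by exact_mod_cast hMh1
  have hM8r : (8 : ℝ) ≤ Mh := by exact_mod_cast hM8
  have h16r : 16 * ((ℓ : ℝ) + 1) ≤ ((ℓ : ℝ) + 1) * Mh := (le_max_right _ _).trans ((le_max_left _ _).trans hM₃)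
  have hM16 : 16 ≤ Mh := by
    have : (16 : ℝ) ≤ Mh := by nlinarith
    exact_mod_cast this
  have hM₁L : ((ℓ : ℝ) + 1) * M₁ ≤ ((ℓ : ℝ) + 1) * Mh := (le_max_left _ _).trans ((le_max_left _ _).trans hM₃)
  have hM₁Mh : M₁ ≤ (Mh : ℝ) := le_of_mul_le_mul_left hM₁L hL0
  have hM : M₁ ≤ ((ℓ : ℝ) + 1) * Mh := by nlinarith
  have hM' : M₁ ≤ ((ℓ : ℝ) + 1) * (Mh1 ℓ a : ℕ) := by
    have e : (((ℓ + 1) * Mh1 ℓ a : ℕ) : ℝ) = (Mh : ℝ) := by exact_mod_cast L_mul_Mh1 hMha hM8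
    push_cast at e
    rw [e]; exact hM₁Mh
  have hlog : 8 / δ * Real.log ((ℓ : ℝ) + 1) + 1 ≤ ((ℓ : ℝ) + 1) * Mh := (le_max_left _ _).trans ((le_max_right _ _).trans hM₃)
  have hN₃r : (N₃ : ℝ) + 1 ≤ ((ℓ : ℝ) + 1) * Mh := (le_max_right _ _).trans ((le_max_right _ _).trans hM₃)
  have hRM : 1 ≤ R * ((ℓ + 1) * Mh) := Nat.one_le_iff_ne_zero.2 (by positivity)
  have hRM₃ : N₃ + 1 ≤ R * ((ℓ + 1) * Mh) := by
    have h1 : ((N₃ + 1 : ℕ) : ℝ) ≤ (((ℓ + 1) * Mh : ℕ) : ℝ) := by push_cast; linarith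
    have h2 : N₃ + 1 ≤ (ℓ + 1) * Mh := by exact_mod_cast h1
    exact h2.trans (Nat.le_mul_of_pos_left _ (by omega))
  have hpc := hpl c
  have habs : |cf| ≠ 0 := abs_ne_zero.2 hcf
  -- ### the torus profile of the chart frame (Lemma 2.1), `κ`
  obtain ⟨hPrT, hKp0, hKanti⟩ := profile_torus (D.chart (svec ℓ k c.1.1 c.1.2)) hMh1 hP1 hN₃0 hRM₃ ha₀'0
    (by rw [hN₃]; exact budget_of_rate d ℓ ha₀'0)
  set Kp : ℝ → ℝ := fun a' => if a₀' ≤ a' then K261 N₃ (d + 1) ((ℓ : ℝ) + 1) 1 (1 * a₀')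
    else max (K261 N₃ (d + 1) ((ℓ : ℝ) + 1) 1 (1 * a₀')) (Fintype.card ↥(bset (D.chart (svec ℓ k c.1.1 c.1.2)).toDomains)) with hKp
  have hKp1 : Kp 1 = K3 := by rw [hK3]; exact if_pos ha₀'1
  have hKpr : Kp ((δ - 2 * κ) / 192) = K3 := by rw [hK3]; exact if_pos ha₀'r
  have hκRM : Real.log ((ℓ : ℝ) + 1) ≤ κ * ((geomTB (D.chart (svec ℓ k c.1.1 c.1.2))).R * (geomTB (D.chart (svec ℓ k c.1.1 c.1.2))).M) := by
    rw [geomTB_RM _ hMh1, hκ]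
    have hR1r : (1 : ℝ) ≤ R := by exact_mod_cast hR1
    have hLM0 : 0 ≤ ((ℓ : ℝ) + 1) * Mh := by positivity
    have h1 : ((ℓ : ℝ) + 1) * Mh ≤ (R : ℝ) * (((ℓ : ℝ) + 1) * Mh) := by nlinarith
    have h2 : 8 / δ * Real.log ((ℓ : ℝ) + 1) ≤ (R : ℝ) * (((ℓ : ℝ) + 1) * Mh) - 1 := by linarith
    have h3 := mul_le_mul_of_nonneg_left h2 (by positivity : (0 : ℝ) ≤ δ / 8)
    have e : δ / 8 * (8 / δ * Real.log ((ℓ : ℝ) + 1)) = Real.log ((ℓ : ℝ) + 1) := by field_simp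
    linarith
  -- ### the window data of `χ_□` and the cut-offs in the chart frame
  have hMc := Mc_pos (ℓ := ℓ) hMh1 c.1.1
  have hlo := hlo_cube hMh1 hP4 c hL hℓ hM8
  have hhi := hhi_cube hN hk hMh1 hP4 hMha c (band_le (d := d) (ℓ := ℓ) hb₀ hb₁) hM8 (wC hN hk c w) cf
  have hwn := hwin_cube hN hMh1 hP4 c hM8 hR2
  have hx₀ := hx0 (Mh := Mh) hpc
  have hfit' := hfitC hN hk hMh1 hP4 hMha c (band_le (d := d) (ℓ := ℓ) hb₀ hb₁) hpc (wC hN hk c w) cf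
  have hζQ : ∀ b, zch hN hMh1 hP4 c b ≠ 0 → blkS hN (D.chart (svec ℓ k c.1.1 c.1.2)) b.src ∈ Qbig (Dch D c) (cc D hMh1 hP4 c) :=
    fun b hb => blkS_mem_Qbig_of_zch hN hMh1 hP4 c hb
  have hhQ : ∀ b, hch hN hMh1 hP4 c b ≠ 0 → blkS hN (D.chart (svec ℓ k c.1.1 c.1.2)) b.src ∈ Qbig (Dch D c) (cc D hMh1 hP4 c) :=
    fun b hb => blkS_mem_Qbig_of_hch hN hMh1 hP4 c (by omega) hR hb
  have hS16 : (16 : ℝ) ≤ (bigSide ℓ Mh c.1.1 : ℝ) := by have := Mh_le_bigSide (ℓ := ℓ) (Mh := Mh) c.1.1; nlinarith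
  have hplat : ∀ x, blkS hN (D.chart (svec ℓ k c.1.1 c.1.2)) x ∈ Qbig (Dch D c) (cc D hMh1 hP4 c) →
      ∀ μ, |lab x μ - ctr (Dch D c) (cc D hMh1 hP4 c) μ| ≤ 3 / 4 * Mc ℓ Mh c.1.1 := by
    intro x hx μ
    have h := abs_lab_sub_ctr_le hN hMh1 hP4 c hM8 hR3 hx μ
    unfold Mc; linarith
  have hnear : ∀ x, blkS hN (D.chart (svec ℓ k c.1.1 c.1.2)) x ∈ Qbig (Dch D c) (cc D hMh1 hP4 c) →
      NearS (ctr (Dch D c) (cc D hMh1 hP4 c)) (Mc ℓ Mh c.1.1) 0 x := by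
    intro x hx μ
    have h := abs_lab_sub_ctr_le hN hMh1 hP4 c hM8 hR3 hx μ
    unfold Mc; linarith
  have hζd : ∀ b, zch hN hMh1 hP4 c b ≠ 0 →
      b.src ∈ DeepS (tC hN hk hMh1 hP4 c (band_le (d := d) (ℓ := ℓ) hb₀ hb₁) a (wC hN hk c w) cf) (x0 ℓ Mh k c.1) 1 :=
    fun b hb => deep_of_near (ctr (Dch D c) (cc D hMh1 hP4 c)) hlo hhi (r := 0) (n := 1) (by norm_num) (hnear _ (hζQ b hb))
  have hhd : ∀ b, hch hN hMh1 hP4 c b ≠ 0 →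
      b.src ∈ DeepS (tC hN hk hMh1 hP4 c (band_le (d := d) (ℓ := ℓ) hb₀ hb₁) a (wC hN hk c w) cf) (x0 ℓ Mh k c.1) 1 :=
    fun b hb => deep_of_near (ctr (Dch D c) (cc D hMh1 hP4 c)) hlo hhi (r := 0) (n := 1) (by norm_num) (hnear _ (hhQ b hb))
  have htgt : ∀ b : PBond (PV d ℓ m K hd hL) 0, blkS hN (D.chart (svec ℓ k c.1.1 c.1.2)) b.src ∈ Qbig (Dch D c) (cc D hMh1 hP4 c) →
      ∀ μ, |lab b.tgt μ - ctr (Dch D c) (cc D hMh1 hP4 c) μ| ≤ 3 / 4 * Mc ℓ Mh c.1.1 := by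
    intro b hb μ
    obtain ⟨-, hlab⟩ := shift_near (ctr (Dch D c) (cc D hMh1 hP4 c)) hfit' hlo hhi (r := 0) (by norm_num) (hnear _ hb) b.dir
    have etgt : b.tgt = b.src.shift b.dir := rfl
    rw [etgt, hlab]
    by_cases hμ : μ = b.dir
    · subst hμ
      rw [Function.update_self]
      have h := abs_lab_sub_ctr_le hN hMh1 hP4 c hM8 hR3 hb b.dir
      unfold Mc
      rw [abs_le] at h ⊢
      constructor <;> linarith [h.1, h.2]
    · rw [Function.update_of_ne hμ]
      exact hplat _ hb μ
  have hEL := hEL_cL (ctr (Dch D c) (cc D hMh1 hP4 c)) cf (hch hN hMh1 hP4 c) (fun b hb => ⟨hplat _ (hhQ b hb), htgt b (hhQ b hb)⟩)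
  -- ### LINE 3 ON THE WINDOW OF THE MEMBER (p22's `line3_window`), THE BOND CUT-OFFS EXCHANGED: `h^ch_□` on the left, `ζ^ch_□` on the right
  have hW := hwin m K hN (D.chart (svec ℓ k c.1.1 c.1.2)) hk
    (t := tC hN hk hMh1 hP4 c (band_le (d := d) (ℓ := ℓ) hb₀ hb₁) a (wC hN hk c w) cf) (x₀ := x0 ℓ Mh k c.1) hx₀ hfit'
    (hN1_cube hN hk hMh1 hP4 hMha c (band_le (d := d) (ℓ := ℓ) hb₀ hb₁) hM8 hR2 (wC hN hk c w) cf)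
    (Dmem hN hk hMh1 hP4 c (band_le (d := d) (ℓ := ℓ) hb₀ hb₁) a (wC hN hk c w) cf)
    (hlevW_cube hN hk hMh1 hP4 hMha c (band_le (d := d) (ℓ := ℓ) hb₀ hb₁) hk2 hM8 hR2 hpc (wC hN hk c w) cf)
    (hal_cube hMh1 hP4 c hL hR2) (j0_hj hMh1 hP4 c a) (jlo := j0 hMh1 hP4 c) (fun z => jlo_cube hMh1 hP4 c z) (Nat.le_succ _)
    hP4 hR hM one_le_Mh1 (four_le_P1 hMh1 hP4 c hℓ1) le_rfl hM' hRM hκ0 hκRM hκδ (Kp := Kp) hPrT hKp0 hKanti hcf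
    (chiC hMh1 hP4 c) (cLC hMh1 hP4 c) (zoneN hN (D.chart (svec ℓ k c.1.1 c.1.2)) (chiC hMh1 hP4 c))
    (zone_nonempty hN hMh1 hP4 hMha c hℓ hM8 hpc)
    (fun x => chiS_nonneg _ _ x) (fun x => chiS_le_one _ _ x)
    (fun x hx => chi_eq_one_of_not_mem_zoneN hN _ _ x hx)
    (fun x hx => chiS_deep _ hlo hhi hMc hx)
    (fun b hb => chiS_jump _ hx₀ hfit' hlo hhi hMc b hb)
    hs₁0 hs₂0 hsb0
    (fun b => hd1_chiS _ hx₀ hfit' hlo hhi hN _ hwn hMc b)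
    (fun e x => hd1'_chiS _ hx₀ hfit' hlo hhi hN _ hwn hMc e x)
    (fun y μ => hd2_chiS _ hx₀ hfit' hlo hhi hN _ hwn hMc y μ)
    (fun x y hxy => hdb_chiS _ hN _ hwn hMc x y hxy)
    (fun y hy => chi_const_of_not_mem_zoneN hN _ _ y hy)
    (fun x => cL_mul_chiS _ hMc x)
    (hch hN hMh1 hP4 c) (zch hN hMh1 hP4 c) (abs_hch_le_one hN hMh1 hP4 c) hhd (abs_zch_le_one hN hMh1 hP4 c) hζd hEL
    (M₀ := (Mh : ℝ) / (4 * ((ℓ : ℝ) + 1)))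
    (fun v hv n hn => depth_cube hN hk hMh1 hP4 hMha c _ hk2 hℓ hM16 hR2 hP5 hpc (wC hN hk c w) cf (hhQ v hv) hn)
    (fun v hv n hn => depth_cube hN hk hMh1 hP4 hMha c _ hk2 hℓ hM16 hR2 hP5 hpc (wC hN hk c w) cf (hζQ v hv) hn)
  -- ### the member block count `|𝔅(T_□)| ≤ A₁·M_h^{d+1}`
  have hcard : (Fintype.card ↥(bset (Dmem hN hk hMh1 hP4 c (band_le (d := d) (ℓ := ℓ) hb₀ hb₁) a (wC hN hk c w) cf).toDomains) : ℝ) ≤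
      A₁ * (Mh : ℝ) ^ (d + 1) := by
    rw [Fintype.card_coe]
    have h := card_bset_famOf_le (Mh₁ := Mh1 ℓ a) (R₁ := 2 * (ℓ + 1)) (P₁ := P1 hMh1 hP4 c)
      (tC hN hk hMh1 hP4 c (band_le (d := d) (ℓ := ℓ) hb₀ hb₁) a (wC hN hk c w) cf).Λ'
    have hj := j0_le_level hMh1 hP4 c hL hR2
    have hfac : ∀ μ, ((Mh1 ℓ a * (ℓ + 1) ^ 2 * P1 hMh1 hP4 c μ : ℕ) : ℝ) ≤ 2 * ((ℓ : ℝ) + 1) ^ 3 * Mh := by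
      intro μ
      have e := L_mul_Mh1 hMha hM8
      have hle : (ℓ + 1) ^ (c.1.1 - j0 hMh1 hP4 c + 1) ≤ (ℓ + 1) ^ 2 := Nat.pow_le_pow_right (Nat.succ_pos ℓ) (by omega)
      have h1 : Mh1 ℓ a * (ℓ + 1) ^ 2 * (2 * (ℓ + 1) ^ (c.1.1 - j0 hMh1 hP4 c + 1)) ≤ Mh1 ℓ a * (ℓ + 1) ^ 2 * (2 * (ℓ + 1) ^ 2) :=
        Nat.mul_le_mul_left _ (Nat.mul_le_mul_left _ hle)
      have h2 : Mh1 ℓ a * (ℓ + 1) ^ 2 * (2 * (ℓ + 1) ^ 2) = 2 * (ℓ + 1) ^ 3 * ((ℓ + 1) * Mh1 ℓ a) := by ring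
      rw [h2, e] at h1
      have h3 : ((Mh1 ℓ a * (ℓ + 1) ^ 2 * (2 * (ℓ + 1) ^ (c.1.1 - j0 hMh1 hP4 c + 1)) : ℕ) : ℝ) ≤ ((2 * (ℓ + 1) ^ 3 * Mh : ℕ) : ℝ) := by
        exact_mod_cast h1
      unfold P1
      push_cast at h3 ⊢
      exact h3
    calc (((bset (Dmem hN hk hMh1 hP4 c (band_le (d := d) (ℓ := ℓ) hb₀ hb₁) a (wC hN hk c w) cf).toDomains).card : ℕ) : ℝ)
        ≤ ((2 * ∏ μ, (Mh1 ℓ a * (ℓ + 1) ^ 2 * P1 hMh1 hP4 c μ) : ℕ) : ℝ) := by exact_mod_cast h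
      _ = 2 * ∏ μ, ((Mh1 ℓ a * (ℓ + 1) ^ 2 * P1 hMh1 hP4 c μ : ℕ) : ℝ) := by push_cast; ring
      _ ≤ 2 * ∏ _μ : Fin (d + 1), (2 * ((ℓ : ℝ) + 1) ^ 3 * Mh) := by
          refine mul_le_mul_of_nonneg_left (Finset.prod_le_prod (fun μ _ => by positivity) fun μ _ => hfac μ) (by norm_num)
      _ = A₁ * (Mh : ℝ) ^ (d + 1) := by rw [Finset.prod_const, Finset.card_univ, Fintype.card_fin, hA₁, mul_pow]; ring
  -- ### the kernel of `line3_window`, cleaned: constants absorbed into `e^{−cM_h}`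
  have hΛ : 2 + (j0 hMh1 hP4 c + 1 - j0 hMh1 hP4 c) = 3 := by omega
  have hs1 : (1 : ℝ) ≤ 1 + A₁ * (Mh : ℝ) ^ (d + 1) := le_add_of_nonneg_right (by positivity)
  have hW2 := hasMajorant_mono (g := geomW hN (D.chart (svec ℓ k c.1.1 c.1.2)) hx₀ hfit'
      (hN1_cube hN hk hMh1 hP4 hMha c (band_le (d := d) (ℓ := ℓ) hb₀ hb₁) hM8 hR2 (wC hN hk c w) cf)
      (Dmem hN hk hMh1 hP4 c (band_le (d := d) (ℓ := ℓ) hb₀ hb₁) a (wC hN hk c w) cf))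
    (blkV1 hN (D.chart (svec ℓ k c.1.1 c.1.2))) hW (K' := fun a' b' =>
      G₀ * B₆ * Real.exp (-(c₁ / 2 * Mh)) * Real.exp (-(c₁ / 4 * Mh)) * (cf ^ 2 /
        (geomW hN (D.chart (svec ℓ k c.1.1 c.1.2)) hx₀ hfit'
            (hN1_cube hN hk hMh1 hP4 hMha c (band_le (d := d) (ℓ := ℓ) hb₀ hb₁) hM8 hR2 (wC hN hk c w) cf)
            (Dmem hN hk hMh1 hP4 c (band_le (d := d) (ℓ := ℓ) hb₀ hb₁) a (wC hN hk c w) cf)).len a' ^ 2) *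
        Real.exp (-((δ - 2 * κ) / 192 *
          (geomW hN (D.chart (svec ℓ k c.1.1 c.1.2)) hx₀ hfit'
            (hN1_cube hN hk hMh1 hP4 hMha c (band_le (d := d) (ℓ := ℓ) hb₀ hb₁) hM8 hR2 (wC hN hk c w) cf)
            (Dmem hN hk hMh1 hP4 c (band_le (d := d) (ℓ := ℓ) hb₀ hb₁) a (wC hN hk c w) cf)).dist a' b'))) (by
    intro a' b'
    refine mul_le_mul_of_nonneg_right ?_ (Real.exp_pos _).le
    rw [hKp1, hKpr, hΛ, div_pow, sq_abs, div_div_eq_mul_div, mul_div_assoc]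
    refine mul_le_mul_of_nonneg_right ?_ (by positivity)
    have he₀ : (δ - 2 * κ) / 96 * ((Mh : ℝ) / (4 * ((ℓ : ℝ) + 1))) = c₁ * Mh := by rw [hc₁]; field_simp
    -- `θ₂` does not depend on the fine factor
    have hu : |cf| * |cf|⁻¹ = 1 := mul_inv_cancel₀ habs
    have hθeq : ((Finset.univ : Finset (Fin (d + 1) × Bool)).card : ℝ) *
          ((((ℓ : ℝ) + 1) ^ 3) * (|cf| * D1 thetaProf) * (Real.exp (1 + δ) * K3 * |cf|⁻¹ * (((d : ℝ) + 1) * |cf|⁻¹ * C) * |cf|) +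
            (((ℓ : ℝ) + 1) ^ 3) ^ 2 * 0 * C) +
          (((ℓ : ℝ) + 1) ^ 3) ^ 2 * (((d : ℝ) + 1) * D2 thetaProf + ((d : ℝ) + 1) * D1 thetaProf) * C = Θ₂ := by
      rw [hΘ₂]
      have e : (((ℓ : ℝ) + 1) ^ 3) * (|cf| * D1 thetaProf) * (Real.exp (1 + δ) * K3 * |cf|⁻¹ * (((d : ℝ) + 1) * |cf|⁻¹ * C) * |cf|) =
          (((ℓ : ℝ) + 1) ^ 3) * D1 thetaProf * (Real.exp (1 + δ) * K3 * (((d : ℝ) + 1) * C)) := by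
        calc _ = (((ℓ : ℝ) + 1) ^ 3) * D1 thetaProf * (Real.exp (1 + δ) * K3 * (((d : ℝ) + 1) * C)) * (|cf| * |cf|⁻¹) *
            (|cf| * |cf|⁻¹) := by ring
          _ = _ := by rw [hu]; ring
      rw [e]; ring
    rw [he₀, div_one, hθeq, ← hθ]
    have hKx0 : 0 ≤ K3 * (1 + (Fintype.card ↥(bset (Dmem hN hk hMh1 hP4 c (band_le (d := d) (ℓ := ℓ) hb₀ hb₁) a
        (wC hN hk c w) cf).toDomains) : ℝ)) := by positivity
    have hL3 : (0 : ℝ) ≤ ((ℓ : ℝ) + 1) ^ 3 := by positivity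
    have hC₁ : (0 : ℝ) ≤ ((d : ℝ) + 1) * C := by positivity
    refine (mul_le_mul_of_nonneg_right (CDgk_mono (Kx' := (1 + A₁ * (Mh : ℝ) ^ (d + 1)) * K3)
      hL3 hC.le hC.le hC₁ hθ0 hΘ₂0 hKx0 le_rfl ?_) (Real.exp_pos _).le).trans ?_
    · rw [mul_comm]
      exact mul_le_mul_of_nonneg_right (by linarith [hcard]) hK30
    · refine (mul_le_mul_of_nonneg_right (CDgk_scale hL3 hC.le hC.le hC₁ hθ0 hΘ₂0 hK30 hs1) (Real.exp_pos _).le).trans ?_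
      rw [← hG₀]
      have h := absorb (d + 1) hG₀0 hc₁0 hMr hA₁0 (s := 1 + A₁ * (Mh : ℝ) ^ (d + 1)) rfl le_rfl
      rw [← hB₆] at h
      exact h)
  -- ### the cut from `d′` to `d_T` (located pairs have diameter `≤ c_Δ·M_h`)
  have hdiam : ∀ v, hch hN hMh1 hP4 c v ≠ 0 → ∀ v', zch hN hMh1 hP4 c v' ≠ 0 →
      (geomTB (D.chart (svec ℓ k c.1.1 c.1.2))).dist (blkV1 hN (D.chart (svec ℓ k c.1.1 c.1.2)) v)
        (blkV1 hN (D.chart (svec ℓ k c.1.1 c.1.2)) v') ≤ cΔ * Mh := by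
    intro v hv v' hv'
    rw [hcΔ]
    exact distT_le_of_mem_Qbig hMh1 hP4 c hL hM8 hR2 (hhQ v hv) (hζQ v' hv')
  have hcut := hasMajorant_cut_of_diam hN (D.chart (svec ℓ k c.1.1 c.1.2)) hx₀ hfit'
    (hN1_cube hN hk hMh1 hP4 hMha c (band_le (d := d) (ℓ := ℓ) hb₀ hb₁) hM8 hR2 (wC hN hk c w) cf)
    (Dmem hN hk hMh1 hP4 c (band_le (d := d) (ℓ := ℓ) hb₀ hb₁) a (wC hN hk c w) cf)
    (hch hN hMh1 hP4 c) (zch hN hMh1 hP4 c) hW2 hdiam (by positivity) (ρ := c₁ / 4 / cΔ) (by positivity)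
  -- ### the chart-frame operator, then the global frame
  have hchart := hasMajorant_of_eq (g := geomT (D.chart (svec ℓ k c.1.1 c.1.2))) (blk' := blkV1 hN (D.chart (svec ℓ k c.1.1 c.1.2)))
    (chart_eq_line3_transpose hN hk hMh1 hP4 hMha c (band_le (d := d) (ℓ := ℓ) hb₀ hb₁) hk2 hM8 hR2 hpc (wC hN hk c w) hcf hζd hhd)
    (hasMajorant_T_of_TB hN hcut)
  rw [target_eq_conj_transpose hN hk hMh1 hP4 hMha c (band_le (d := d) (ℓ := ℓ) hb₀ hb₁) hpc w cf]
  refine hasMajorant_TB hN (hasMajorant_conj_chart hN D hMh1 hP1 (svec ℓ k c.1.1 c.1.2) hchart ?_ ?_)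
  · intro a' b'
    have hdist : (geomTB D).dist (blkMap D (svec ℓ k c.1.1 c.1.2) a') (blkMap D (svec ℓ k c.1.1 c.1.2) b') =
        (geomTB (D.chart (svec ℓ k c.1.1 c.1.2))).dist a' b' := by
      show (((bondT D).dist _ _ : ℕ) : ℝ) = (((bondT (D.chart (svec ℓ k c.1.1 c.1.2))).dist a' b' : ℕ) : ℝ)
      rw [distT_chart_eq hMh1 hP1]
    have e1 : c₁ / 4 / cΔ * (cΔ * Mh) = c₁ / 4 * Mh := by field_simp
    have e2 : c₁ / 2 / ((ℓ : ℝ) + 1) * (((ℓ : ℝ) + 1) * Mh) = c₁ / 2 * Mh := by field_simp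
    rw [geomW_len, geomTB_M, geomTB_len, geomTB_len, blkMap_fst D hMh1 hP1, hdist, e1, e2]
    have h1 : Real.exp (-(c₁ / 4 * (Mh : ℝ))) * Real.exp (c₁ / 4 * (Mh : ℝ)) = 1 := by
      rw [← Real.exp_add, neg_add_cancel, Real.exp_zero]
    exact kernel_rearrange h1
  · intro a' b'; positivity

end Main

/-! ## §4  The transposed line 3 for the cube members of the PADDED family `padT D` (every odd `L ≥ 5`, no placement hypothesis) -/

section Pad

open Classical in
/-- **THE TRANSPOSED LINE 3 OF (2.92) FOR THE GENUINE MEMBER OF EVERY CUBE OF THE PADDED FAMILY `padT D`** (all cubes placed: `placed_pad`) —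
`line3_cube_transpose` at `(hN_pad hN hLP, padT D hLP, hk'_of_V1)`, `hLP := hLP_of_V1 hN hMha hP`; stated on the ORIGINAL data (`hN`, `D`, `hk`, `k ≥ 1`,
`M_h = L^a ≥ 8`, `R ≥ 2L²`, `P′ ≥ 5L`, `ℓ ≥ 4`, `M₃ ≤ L·M_h`, `c_f ≠ 0`, any weights `w`) — binders VERBATIM those of p22's `B6Line3CubePadV1L0.line3_cube_pad`,
the operator's cut-offs exchanged. [cite: Balaban1984PropagatorsII, (2.92) p.239 (line 3), (2.134), (2.141) p.247, (2.1)–(2.4) p.224, (2.36) p.229; assembly ours] -/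
theorem line3_cube_transpose_pad (d ℓ : ℕ) (hd : 1 ≤ d + 1) (hL : Odd (ℓ + 1) ∧ 1 < ℓ + 1) {b₀ b₁ : ℝ} (hb₀ : 0 < b₀) (hb₁ : b₀ ≤ b₁) :
    ∃ ρ₃ CD cD M₃ : ℝ, 0 < ρ₃ ∧ 0 ≤ CD ∧ 0 < cD ∧
    ∀ (m K : ℕ) {Mh k R : ℕ} {P' : Fin (d + 1) → ℕ}
      (hN : ∀ μ, N0 ℓ Mh k P' μ = (PV d ℓ m K hd hL).sitesPerDir 0) (D : B6MultiLevelTorusOperatorL0.TDomains d ℓ Mh k P' R) (hk : k ≤ m + K) (_ : 1 ≤ k)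
      {a : ℕ} (hMha : Mh = (ℓ + 1) ^ a) (hM8 : 8 ≤ Mh) (_ : 2 * (ℓ + 1) ^ 2 ≤ R) (hP : ∀ μ, 5 * (ℓ + 1) ≤ P' μ) (_ : 4 ≤ ℓ)
      (_ : M₃ ≤ ((ℓ : ℝ) + 1) * Mh)
      {cf : ℝ} (_ : cf ≠ 0) (w : BondIdx (B6GlobalChartV1L0.domT hN D hk) → ℝ) (c : ↥(cubes (padT D (hLP_of_V1 hN hMha hP)).toDomains)),
      HasMajorant (g := geomTB (padT D (hLP_of_V1 hN hMha hP))) (blkV1 (hN_pad hN (hLP_of_V1 hN hMha hP)) (padT D (hLP_of_V1 hN hMha hP)))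
        (mulOp (hB (hN_pad hN (hLP_of_V1 hN hMha hP)) (padT D (hLP_of_V1 hN hMha hP)) c) *
          (onFun (dE (P := PV d ℓ m K hd hL) cf ∘ₗ
              (LinearMap.id - RE (domT (hN_pad hN (hLP_of_V1 hN hMha hP)) (padT D (hLP_of_V1 hN hMha hP)) (hk'_of_V1 hN hMha hP)) cf) ∘ₗ dsE cf) -
            Pl (hN_pad hN (hLP_of_V1 hN hMha hP)) (hk'_of_V1 hN hMha hP) (one_le_of_eight_le hM8) (four_le_of_five_le (hP5_of_V1 hP)) hMha c
              (band_le (d := d) (ℓ := ℓ) hb₀ hb₁) (placed_pad D (hLP_of_V1 hN hMha hP) (hP5_of_V1 hP) c)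
              (w ∘ (sameOm_domT_pad hN D hk (hLP_of_V1 hN hMha hP) (hk'_of_V1 hN hMha hP)).idxB) cf) *
          mulOp (zB (hN_pad hN (hLP_of_V1 hN hMha hP)) (padT D (hLP_of_V1 hN hMha hP)) (one_le_of_eight_le hM8)
            (four_le_of_five_le (hP5_of_V1 hP)) c))
        (fun y y'' => CD * cf ^ 2 * Real.exp (-(cD * (geomTB (padT D (hLP_of_V1 hN hMha hP))).M)) /
          (geomTB (padT D (hLP_of_V1 hN hMha hP))).len y ^ 2 * Real.exp (-(ρ₃ * (geomTB (padT D (hLP_of_V1 hN hMha hP))).dist y y''))) := by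
  obtain ⟨ρ₃, CD, cD, M₃, hρ₃, hCD, hcD, hcube⟩ := line3_cube_transpose d ℓ hd hL hb₀ hb₁
  refine ⟨ρ₃, CD, cD, M₃, hρ₃, hCD, hcD, ?_⟩
  intro m K Mh k R P' hN D hk hk1 a hMha hM8 hR2 hP hℓ hM cf hcf w c
  exact hcube m K (hN_pad hN (hLP_of_V1 hN hMha hP)) (padT D (hLP_of_V1 hN hMha hP)) (hk'_of_V1 hN hMha hP) (by omega) hMha hM8 hR2
    (hP5_of_V1 hP) hℓ (fun c' => placed_pad D (hLP_of_V1 hN hMha hP) (hP5_of_V1 hP) c') hM hcf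
    (w ∘ (sameOm_domT_pad hN D hk (hLP_of_V1 hN hMha hP) (hk'_of_V1 hN hMha hP)).idxB) c

open Classical in
/-- **THE SAME AT ANY RATE `r ≤ ρ₃`** (the majorant kernel is monotone in the rate) — the shape a walk assembly quantifies over.
[cite: Balaban1984PropagatorsII, (2.92) p.239 (line 3), (2.134), (2.141) p.247, (2.36) p.229; assembly ours] -/
theorem line3_cube_transpose_pad_le (d ℓ : ℕ) (hd : 1 ≤ d + 1) (hL : Odd (ℓ + 1) ∧ 1 < ℓ + 1) {b₀ b₁ : ℝ} (hb₀ : 0 < b₀) (hb₁ : b₀ ≤ b₁) :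
    ∃ ρ₃ CD cD M₃ : ℝ, 0 < ρ₃ ∧ 0 ≤ CD ∧ 0 < cD ∧
    ∀ (r : ℝ), r ≤ ρ₃ →
    ∀ (m K : ℕ) {Mh k R : ℕ} {P' : Fin (d + 1) → ℕ}
      (hN : ∀ μ, N0 ℓ Mh k P' μ = (PV d ℓ m K hd hL).sitesPerDir 0) (D : B6MultiLevelTorusOperatorL0.TDomains d ℓ Mh k P' R) (hk : k ≤ m + K) (_ : 1 ≤ k)
      {a : ℕ} (hMha : Mh = (ℓ + 1) ^ a) (hM8 : 8 ≤ Mh) (_ : 2 * (ℓ + 1) ^ 2 ≤ R) (hP : ∀ μ, 5 * (ℓ + 1) ≤ P' μ) (_ : 4 ≤ ℓ)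
      (_ : M₃ ≤ ((ℓ : ℝ) + 1) * Mh)
      {cf : ℝ} (_ : cf ≠ 0) (w : BondIdx (B6GlobalChartV1L0.domT hN D hk) → ℝ) (c : ↥(cubes (padT D (hLP_of_V1 hN hMha hP)).toDomains)),
      HasMajorant (g := geomTB (padT D (hLP_of_V1 hN hMha hP))) (blkV1 (hN_pad hN (hLP_of_V1 hN hMha hP)) (padT D (hLP_of_V1 hN hMha hP)))
        (mulOp (hB (hN_pad hN (hLP_of_V1 hN hMha hP)) (padT D (hLP_of_V1 hN hMha hP)) c) *
          (onFun (dE (P := PV d ℓ m K hd hL) cf ∘ₗ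
              (LinearMap.id - RE (domT (hN_pad hN (hLP_of_V1 hN hMha hP)) (padT D (hLP_of_V1 hN hMha hP)) (hk'_of_V1 hN hMha hP)) cf) ∘ₗ dsE cf) -
            Pl (hN_pad hN (hLP_of_V1 hN hMha hP)) (hk'_of_V1 hN hMha hP) (one_le_of_eight_le hM8) (four_le_of_five_le (hP5_of_V1 hP)) hMha c
              (band_le (d := d) (ℓ := ℓ) hb₀ hb₁) (placed_pad D (hLP_of_V1 hN hMha hP) (hP5_of_V1 hP) c)
              (w ∘ (sameOm_domT_pad hN D hk (hLP_of_V1 hN hMha hP) (hk'_of_V1 hN hMha hP)).idxB) cf) *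
          mulOp (zB (hN_pad hN (hLP_of_V1 hN hMha hP)) (padT D (hLP_of_V1 hN hMha hP)) (one_le_of_eight_le hM8)
            (four_le_of_five_le (hP5_of_V1 hP)) c))
        (fun y y'' => CD * cf ^ 2 * Real.exp (-(cD * (geomTB (padT D (hLP_of_V1 hN hMha hP))).M)) /
          (geomTB (padT D (hLP_of_V1 hN hMha hP))).len y ^ 2 * Real.exp (-(r * (geomTB (padT D (hLP_of_V1 hN hMha hP))).dist y y''))) := by
  obtain ⟨ρ₃, CD, cD, M₃, hρ₃, hCD, hcD, hcube⟩ := line3_cube_transpose_pad d ℓ hd hL hb₀ hb₁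
  refine ⟨ρ₃, CD, cD, M₃, hρ₃, hCD, hcD, ?_⟩
  intro r hr m K Mh k R P' hN D hk hk1 a hMha hM8 hR2 hP hℓ hM cf hcf w c
  refine hasMajorant_mono (g := geomTB (padT D (hLP_of_V1 hN hMha hP))) (blkV1 (hN_pad hN (hLP_of_V1 hN hMha hP)) (padT D (hLP_of_V1 hN hMha hP)))
    (hcube m K hN D hk hk1 hMha hM8 hR2 hP hℓ hM hcf w c) ?_
  intro y y''
  have hd0 : 0 ≤ (geomTB (padT D (hLP_of_V1 hN hMha hP))).dist y y'' := Nat.cast_nonneg _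
  refine mul_le_mul_of_nonneg_left (Real.exp_le_exp.2 (by nlinarith)) ?_
  have := B6Prop26KLevelAssemblyV1L0.lenTB_pos (D := padT D (hLP_of_V1 hN hMha hP)) y
  positivity

end Pad

end Literature.MathematicalPhysics.QuantumFieldTheory.Balaban1983to89.B6Line3CubeTransposeV1L0
end
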